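import Summits.BirchSwinnertonDyer.BirchSwinnertonDyer.Theorems.CyclotomicUntwistSigmaLineFamilyThetaAtPoints
import Summits.BirchSwinnertonDyer.BirchSwinnertonDyer.Theorems.CyclotomicUntwistSigmaLineFamilyValues
import Literature.NumberTheory.EllipticCurves.VariableChangePoints
import Literature.NumberTheory.EllipticCurves.CanonicalPAdicHeightSigmaThetaProofs
import Literature.NumberTheory.EllipticCurves.LocalDenominatorLawIdentityComponent
import Literature.NumberTheory.EllipticCurves.PadicFormalLogOrder
import HarnessLib

/-!
# Route `CyclotomicUntwist`, crux K1 `PSRankOneLowerHalfAtThree` (stmt-BirchSwinnertonDyer-21580):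
# the σ-LINE FAMILY — QUADRATICITY: the theta relation at deep points for EVERY member `σ_c`
# (`c ∈ ℤ_p`) of the formal sigma family of a `p`-integral curve, at ANY prime, and the
# PARALLELOGRAM LAW `h(P+Q) + h(P−Q) = 2h(P) + 2h(Q)` of the `σ_c`-heights on the deep admissible locus

Cell `pub/bsd-wall` (D-0145 line `route-BirchSwinnertonDyer-CyclotomicUntwist`), seat `bsd-line-cycu-p1`
g4 (K1 base). THEOREMS ONLY (no definition, no named fact, no `sorry`); helper `--supports` K1 =
stmt-BirchSwinnertonDyer-21580. Sequel of `…SigmaLineFamilyThetaAtPoints.lean` (theta at points of the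
dilated model) and `…SigmaLineFamilyValues.lean`. BSD is not proved by this file and nothing here is
evidence for or against K1/K2.

This closes, on the DEEP locus, the census cell's caveat «existence of a BILINEAR datum with this
quadratic form (Bernardi quadraticity of `σ_c`-heights at an additive prime) is not a tree theorem»
(`Rank1Residual/Additive/CensusX42Height.lean`) as far as the parallelogram law goes; the passage from
the parallelogram law on a finite-index torsion-free subgroup to a bilinear datum is the tree's
`exists_pairing_of_parallelogram` road (`CanonicalPAdicHeightSigmaThetaProofs.lean`), not redone here.

* §1 `theta_at_points_formalSigma` — for a `p`-integral elliptic `V/ℚ_p` (ANY reduction type), `c ∈ ℤ_p`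
  and `P = (x₁,y₁)`, `Q = (x₂,y₂) ∈ V(ℚ_p)` with `‖xᵢ‖_p > p⁴` (`v_p(z) ≥ 3`):
  `σ_c(z(P+Q))·σ_c(z(P−Q)) = (x₂ − x₁)·σ_c(z(P))²·σ_c(z(Q))²`, `σ_c(z) = (formalSigma V c)(z)` — the
  relation for the integral member `p⁻²σ_c(p²·)` of the `p²`-dilated model (`theta_at_points_dilated`)
  read through the isomorphism of points `(x, y) ↦ (p⁴x, p⁶y)` (tree `VariableChange.pointEquiv`,
  additive), under which `z ↦ z/p²`; the powers of `p` cancel (`X = z²x` has weight `0`).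
  `norm_param_lt`: `‖x‖ > p⁴ ⇒ ‖z‖ < p⁻²`.
* §2 **`sigmaHeight_formalSigma_parallelogram`** — for `W/ℚ` globally minimal, ANY prime `p`, `c ∈ ℤ_p`,
  `h = CensusX42.sigmaHeight W p (formalSigma (W ⊗ ℚ_p) c)` (`= log_p den x − 2 log_p σ_c(−x/y)`), and
  rational `P, Q` with `P ± Q` affine, `x(P) ≠ x(Q)`, all four points deep at `p` (`‖x‖_p > p⁴`) and `Q`
  reducing non-singularly at every prime: **`h(P+Q) + h(P−Q) = 2h(P) + 2h(Q)`** — Néron's denominator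
  law (tree `den_mul_den_eq_of_hasNonsingularReductionAt_right`) + §1 + `log_p(−1) = 0`;
  `padicEval_formalSigma_param_ne_zero` (`σ_c(z(P)) ≠ 0` at deep points, from `‖σ_c(t)‖ = ‖t‖`).

So at an ADDITIVE prime too every `σ_c`-height (`c ∈ ℤ_p`; by the height difference law also the
`R`-valued affine members `c ∈ R`, whose difference from `h_{σ_{c₀}}` is the quadratic form
`(c − c₀)·log²`) is a quadratic function on the deep admissible points — Mazur–Stein–Tate 2006 §2.6–2.7
/ Bernardi 1981 for the whole family, binder-free in `c` and in the reduction type.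

References: Mazur–Stein–Tate, Doc. Math. Extra Vol. (2006) §2.6–2.7; Bernardi, Progr. Math. 12 (1981)
§1; Mazur–Tate, Duke Math. J. 62 (1991) Thm. 3.1; Stein–Wuthrich, Math. Comp. 82 (2013) §4.1 (4.1);
Silverman AEC III.1, VII.2.2, VIII (Néron's local heights / denominators). [cite: MazurSteinTate2006, §2.7]
[cite: MazurTate1991, Thm. 3.1] [cite: SteinWuthrich2013, §4.1 eq. (4.1)] [cite: SilvermanAEC2009, VII.2.2]
-/

set_option autoImplicit false
-- single-conjunct summit: `Summit.BirchSwinnertonDyer.BirchSwinnertonDyer.…` repeats the name by design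
set_option linter.dupNamespace false

noncomputable section

open scoped Classical

open PowerSeries WeierstrassCurve Literature.NumberTheory.EllipticCurves
  Summit.BirchSwinnertonDyer.BirchSwinnertonDyer.Theorems.PSSigmaLineFamily
  Summit.BirchSwinnertonDyer.BirchSwinnertonDyer.Theorems.PSSigmaLineFamilyEvaluation
  Summit.BirchSwinnertonDyer.BirchSwinnertonDyer.Theorems.PSSigmaLineFamilyConvergence
  Summit.BirchSwinnertonDyer.BirchSwinnertonDyer.Theorems.PSSigmaLineFamilyDilatedPair
  Summit.BirchSwinnertonDyer.BirchSwinnertonDyer.Theorems.PSSigmaLineFamilyThetaAtPoints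

namespace Summit.BirchSwinnertonDyer.BirchSwinnertonDyer.Theorems.PSSigmaLineFamilyParallelogram

variable {p : ℕ} [Fact p.Prime]

/-! ### §1 Theta at DEEP points of `V` itself, for every member `σ_c`, `c ∈ ℤ_p` -/

section Padic

variable (V : WeierstrassCurve ℚ_[p]) [V.IsElliptic] [V.IsIntegral ℤ_[p]]

omit [V.IsElliptic] in
/-- For a point of `E₁` with `‖x‖ > p⁴` the parameter `z = −x/y` satisfies `‖z‖ < p⁻²` (`‖z‖² = 1/‖x‖`).
[Silverman AEC VII.2.2] [folklore] -/
theorem norm_param_lt {x y : ℚ_[p]} (heq : V.toAffine.Equation x y) (hx : (p : ℝ) ^ 4 < ‖x‖) :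
    ‖-x / y‖ < ‖(p : ℚ_[p]) ^ 2‖ := by
  have hp : (1 : ℝ) ≤ p := by exact_mod_cast (Fact.out : p.Prime).one_le
  have hp0 : (0 : ℝ) < p := by positivity
  have hx1 : 1 < ‖x‖ := lt_of_le_of_lt (one_le_pow₀ hp) hx
  obtain ⟨hsq, hxy⟩ := V.norm_sq_eq_norm_cube heq hx1
  have hy0 : 0 < ‖y‖ := (one_pos.trans hx1).trans hxy
  have hz : ‖-x / y‖ ^ 2 = ‖x‖⁻¹ := by
    rw [norm_div, norm_neg, div_pow, hsq]
    have hx0 : ‖x‖ ≠ 0 := (one_pos.trans hx1).ne'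
    field_simp
  have hlt : ‖-x / y‖ ^ 2 < (‖(p : ℚ_[p]) ^ 2‖) ^ 2 := by
    rw [hz, norm_pow, Padic.norm_p, ← pow_mul]
    rw [show 2 * 2 = 4 by norm_num, inv_pow]
    exact inv_strictAnti₀ (by positivity) hx
  exact lt_of_pow_lt_pow_left₀ 2 (norm_nonneg _) hlt

/-- **THETA AT DEEP POINTS, every member.** For a `p`-integral elliptic `V/ℚ_p` (any reduction type),
`c ∈ ℤ_p`, and `P = (x₁,y₁)`, `Q = (x₂,y₂) ∈ V(ℚ_p)` with `‖xᵢ‖ > p⁴` (i.e. `v_p(z) ≥ 3`):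
`σ_c(z(P+Q))·σ_c(z(P−Q)) = (x₂ − x₁)·σ_c(z(P))²·σ_c(z(Q))²`, `σ_c(z) := (formalSigma V c)(z)`. Proof:
read the relation for the integral member `p⁻²σ_c(p²·)` of the dilated model
(`theta_at_points_dilated`) through the isomorphism of points `(x,y) ↦ (p⁴x, p⁶y)`
(`VariableChange.pointMap`, additive), under which `z ↦ z/p²` and `x ↦ p⁴x`; the powers of `p` cancel.
[Mazur–Tate 1991, Thm. 3.1; Bernardi 1981, §1] [cite: MazurTate1991, Thm. 3.1] -/
theorem theta_at_points_formalSigma {c : ℚ_[p]} (hc : ‖c‖ ≤ 1) {x₁ y₁ x₂ y₂ : ℚ_[p]}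
    (h₁ : V.toAffine.Nonsingular x₁ y₁) (h₂ : V.toAffine.Nonsingular x₂ y₂)
    (hx₁ : (p : ℝ) ^ 4 < ‖x₁‖) (hx₂ : (p : ℝ) ^ 4 < ‖x₂‖) :
    padicEval (V.formalSigma c) (V.formalParameter (.some x₁ y₁ h₁ + .some x₂ y₂ h₂)) *
        padicEval (V.formalSigma c) (V.formalParameter (.some x₁ y₁ h₁ - .some x₂ y₂ h₂)) =
      (x₂ - x₁) * padicEval (V.formalSigma c) (-x₁ / y₁) ^ 2 * padicEval (V.formalSigma c) (-x₂ / y₂) ^ 2 := by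
  have hpp : p.Prime := Fact.out
  have hp0 : (p : ℚ_[p]) ≠ 0 := by exact_mod_cast hpp.ne_zero
  have hp2 : (p : ℚ_[p]) ^ 2 ≠ 0 := pow_ne_zero 2 hp0
  set U : ℚ_[p]ˣ := Units.mk0 ((p : ℚ_[p]) ^ 2) hp2 with hU
  set dil : VariableChange ℚ_[p] := ⟨U⁻¹, 0, 0, 0⟩ with hdil
  set vc : VariableChange ℚ_[p] := ⟨U, 0, 0, 0⟩ with hvc
  set V' : WeierstrassCurve ℚ_[p] := dil • V with hV'
  have hV : vc • V' = V := by
    rw [hV', ← mul_smul]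
    have h1 : vc * dil = 1 := by
      rw [hvc, hdil, VariableChange.mul_def, VariableChange.one_def]
      congr 1 <;> simp
    rw [h1, one_smul]
  have hu : (vc.u : ℚ_[p]) = (p : ℚ_[p]) ^ 2 := by rw [hvc]; exact Units.val_mk0 hp2
  -- the points on `V'`
  have hX : ∀ x : ℚ_[p], dil.toX x = (p : ℚ_[p]) ^ 4 * x := fun x => by
    rw [VariableChange.toX_def, hdil]
    simp only [inv_inv, sub_zero]
    rw [hU, Units.val_mk0]; ring
  have hY : ∀ x y : ℚ_[p], dil.toY x y = (p : ℚ_[p]) ^ 6 * y := fun x y => by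
    rw [VariableChange.toY_def, hdil]
    simp only [inv_inv, sub_zero, zero_mul]
    rw [hU, Units.val_mk0]; ring
  have h₁' : V'.toAffine.Nonsingular (dil.toX x₁) (dil.toY x₁ y₁) := (VariableChange.nonsingular_iff V dil x₁ y₁).mpr h₁
  have h₂' : V'.toAffine.Nonsingular (dil.toX x₂) (dil.toY x₂ y₂) := (VariableChange.nonsingular_iff V dil x₂ y₂).mpr h₂
  have hp4 : ‖(p : ℚ_[p]) ^ 4‖ = ((p : ℝ) ^ 4)⁻¹ := by rw [norm_pow, Padic.norm_p, inv_pow]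
  have hpR : (0 : ℝ) < (p : ℝ) ^ 4 := by have := hpp.pos; positivity
  have hx₁' : 1 < ‖dil.toX x₁‖ := by
    rw [hX, norm_mul, hp4]
    rwa [inv_mul_eq_div, one_lt_div hpR]
  have hx₂' : 1 < ‖dil.toX x₂‖ := by
    rw [hX, norm_mul, hp4]
    rwa [inv_mul_eq_div, one_lt_div hpR]
  have hθ := theta_at_points_dilated V V' vc hu rfl rfl rfl hV hc h₁' h₂' hx₁' hx₂'
  -- the point map `V(ℚ_p) → V'(ℚ_p)` and the parameters
  set φ := VariableChange.pointEquiv V dil with hφ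
  have hφP : φ (.some x₁ y₁ h₁) = .some (dil.toX x₁) (dil.toY x₁ y₁) h₁' := VariableChange.pointEquiv_some V dil h₁
  have hφQ : φ (.some x₂ y₂ h₂) = .some (dil.toX x₂) (dil.toY x₂ y₂) h₂' := VariableChange.pointEquiv_some V dil h₂
  have hparam : ∀ R : V.toAffine.Point, V'.formalParameter (φ R) = ((p : ℚ_[p]) ^ 2)⁻¹ * V.formalParameter R := by
    intro R
    rcases R with _ | ⟨x, y, h⟩
    · change V'.formalParameter (φ 0) = ((p : ℚ_[p]) ^ 2)⁻¹ * V.formalParameter 0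
      rw [map_zero]
      change (0 : ℚ_[p]) = ((p : ℚ_[p]) ^ 2)⁻¹ * 0
      rw [mul_zero]
    · rw [VariableChange.pointEquiv_some V dil h]
      show -(dil.toX x) / (dil.toY x y) = ((p : ℚ_[p]) ^ 2)⁻¹ * (-x / y)
      rw [hX, hY]
      rcases eq_or_ne y 0 with hy | hy
      · rw [hy, mul_zero, div_zero, div_zero, mul_zero]
      · field_simp
  have hsum : (.some (dil.toX x₁) (dil.toY x₁ y₁) h₁' : V'.toAffine.Point) + .some (dil.toX x₂) (dil.toY x₂ y₂) h₂' =
      φ (.some x₁ y₁ h₁ + .some x₂ y₂ h₂) := by rw [map_add, hφP, hφQ]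
  have hdiff : (.some (dil.toX x₁) (dil.toY x₁ y₁) h₁' : V'.toAffine.Point) - .some (dil.toX x₂) (dil.toY x₂ y₂) h₂' =
      φ (.some x₁ y₁ h₁ - .some x₂ y₂ h₂) := by rw [map_sub, hφP, hφQ]
  -- the member of the dilated family, evaluated
  have hσ' : ∀ z : ℚ_[p], padicEval (V'.formalSigma ((p : ℚ_[p]) ^ 4 * c)) (((p : ℚ_[p]) ^ 2)⁻¹ * z) =
      ((p : ℚ_[p]) ^ 2)⁻¹ * padicEval (V.formalSigma c) z := by
    intro z
    rw [formalSigma_of_scaling V V' vc hu rfl rfl rfl hV c, padicEval_C_mul', ← padicEval_mul_eq_padicEval_rescale,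
      mul_inv_cancel_left₀ hp2]
  have hz₁ : -(dil.toX x₁) / dil.toY x₁ y₁ = ((p : ℚ_[p]) ^ 2)⁻¹ * (-x₁ / y₁) := by
    have := hparam (.some x₁ y₁ h₁); rwa [hφP] at this
  have hz₂ : -(dil.toX x₂) / dil.toY x₂ y₂ = ((p : ℚ_[p]) ^ 2)⁻¹ * (-x₂ / y₂) := by
    have := hparam (.some x₂ y₂ h₂); rwa [hφQ] at this
  rw [hsum, hdiff, hparam, hparam, hz₁, hz₂, hσ', hσ', hσ', hσ', hX, hX] at hθ
  -- cancel the powers of `p`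
  have hq : ((p : ℚ_[p]) ^ 2)⁻¹ ≠ 0 := inv_ne_zero hp2
  have e : (p : ℚ_[p]) ^ 4 * ((p : ℚ_[p]) ^ 2)⁻¹ ^ 2 = 1 := by field_simp
  have key : ((p : ℚ_[p]) ^ 2)⁻¹ ^ 2 *
      (padicEval (V.formalSigma c) (V.formalParameter (.some x₁ y₁ h₁ + .some x₂ y₂ h₂)) *
        padicEval (V.formalSigma c) (V.formalParameter (.some x₁ y₁ h₁ - .some x₂ y₂ h₂))) =
      ((p : ℚ_[p]) ^ 2)⁻¹ ^ 2 *
        ((x₂ - x₁) * padicEval (V.formalSigma c) (-x₁ / y₁) ^ 2 * padicEval (V.formalSigma c) (-x₂ / y₂) ^ 2) := by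
    linear_combination hθ + (((p : ℚ_[p]) ^ 2)⁻¹ ^ 2 *
      ((x₂ - x₁) * padicEval (V.formalSigma c) (-x₁ / y₁) ^ 2 * padicEval (V.formalSigma c) (-x₂ / y₂) ^ 2)) * e
  exact mul_left_cancel₀ (pow_ne_zero 2 hq) key

end Padic

/-! ### §2 The PARALLELOGRAM LAW of the σ_c-heights on the deep admissible locus -/

section Heights

open Summit.BirchSwinnertonDyer.Rank1Residual.Additive

variable (W : WeierstrassCurve ℚ) [W.IsElliptic] [W.IsGloballyMinimal]

/-- `σ_c` does not vanish at the parameter of a deep point (`‖x‖ > p⁴` ⇒ `z ∈ p²·(punctured disc)`).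
[Bernardi 1981, §1] [cite: MazurTate1991, Thm. 3.1] -/
theorem padicEval_formalSigma_param_ne_zero (V : WeierstrassCurve ℚ_[p]) [V.IsIntegral ℤ_[p]] {c : ℚ_[p]}
    (hc : ‖c‖ ≤ 1) {x y : ℚ_[p]} (heq : V.toAffine.Equation x y) (hx : (p : ℝ) ^ 4 < ‖x‖) :
    padicEval (V.formalSigma c) (-x / y) ≠ 0 := by
  have hp : (1 : ℝ) ≤ p := by exact_mod_cast (Fact.out : p.Prime).one_le
  have hp2 : (p : ℚ_[p]) ^ 2 ≠ 0 := pow_ne_zero 2 (by exact_mod_cast (Fact.out : p.Prime).ne_zero)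
  have hx1 : 1 < ‖x‖ := lt_of_le_of_lt (one_le_pow₀ hp) hx
  obtain ⟨-, hz0, -, -, -⟩ := V.param_facts heq hx1
  have hlt := norm_param_lt V heq hx
  set u : ℚ_[p] := ((p : ℚ_[p]) ^ 2)⁻¹ * (-x / y) with hu
  have hzu : -x / y = (p : ℚ_[p]) ^ 2 * u := by rw [hu, mul_inv_cancel_left₀ hp2]
  have hu1 : ‖u‖ < 1 := by
    rw [hu, norm_mul, norm_inv]
    rw [inv_mul_lt_iff₀ (norm_pos_iff.mpr hp2), mul_one]
    exact hlt
  have hu0 : u ≠ 0 := by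
    rw [hu]; exact mul_ne_zero (inv_ne_zero hp2) hz0
  rw [hzu]
  exact padicEval_formalSigma_ne_zero V hc hu1 hu0

/-- **THE PARALLELOGRAM LAW OF THE σ_c-HEIGHTS (quadraticity on the deep admissible locus, Bernardi /
Mazur–Stein–Tate §2.6–2.7 at an ARBITRARY prime).** Let `W/ℚ` be globally minimal, `p` ANY prime
(additive reduction allowed), `c ∈ ℤ_p`, `σ_c = formalSigma (W ⊗ ℚ_p) c`, and
`h(P) := CensusX42.sigmaHeight W p σ_c P = log_p den x(P) − 2 log_p σ_c(−x/y)`. For rational points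
`P = (x₁,y₁)`, `Q = (x₂,y₂)` with `P ± Q = (x₃,y₃), (x₄,y₄)` affine, `x₁ ≠ x₂`, all four DEEP at `p`
(`‖xᵢ‖_p > p⁴`, i.e. `v_p(z) ≥ 3`) and `Q` with non-singular reduction at every prime:
`h(P+Q) + h(P−Q) = 2h(P) + 2h(Q)`. Proof: Néron's denominator law `d₃d₄ = d₁²d₂²(x₁−x₂)²` (tree
`den_mul_den_eq_of_hasNonsingularReductionAt_right`) and the theta relation at deep points
`σ₃σ₄ = (x₂−x₁)σ₁²σ₂²` (`theta_at_points_formalSigma`), `log_p(−1) = 0`.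
[Mazur–Stein–Tate 2006, §2.6–2.7; Bernardi 1981, §1; Stein–Wuthrich 2013, §4.1 (4.1)]
[cite: MazurSteinTate2006, §2.7] [cite: SteinWuthrich2013, §4.1 eq. (4.1)] -/
theorem sigmaHeight_formalSigma_parallelogram {c : ℚ_[p]} (hc : ‖c‖ ≤ 1)
    {x₁ y₁ x₂ y₂ x₃ y₃ x₄ y₄ : ℚ} (h₁ : W.toAffine.Nonsingular x₁ y₁) (h₂ : W.toAffine.Nonsingular x₂ y₂)
    (h₃ : W.toAffine.Nonsingular x₃ y₃) (h₄ : W.toAffine.Nonsingular x₄ y₄) (hx : x₁ ≠ x₂)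
    (hS : (.some x₁ y₁ h₁ : W.toAffine.Point) + .some x₂ y₂ h₂ = .some x₃ y₃ h₃)
    (hD : (.some x₁ y₁ h₁ : W.toAffine.Point) - .some x₂ y₂ h₂ = .some x₄ y₄ h₄)
    (hx₁ : (p : ℝ) ^ 4 < ‖(x₁ : ℚ_[p])‖) (hx₂ : (p : ℝ) ^ 4 < ‖(x₂ : ℚ_[p])‖)
    (hx₃ : (p : ℝ) ^ 4 < ‖(x₃ : ℚ_[p])‖) (hx₄ : (p : ℝ) ^ 4 < ‖(x₄ : ℚ_[p])‖)
    (hns : ∀ ℓ : ℕ, ℓ.Prime → W.HasNonsingularReductionAt ℓ x₂ y₂) :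
    CensusX42.sigmaHeight W p ((W.baseChange ℚ_[p]).formalSigma c) (.some x₃ y₃ h₃) +
        CensusX42.sigmaHeight W p ((W.baseChange ℚ_[p]).formalSigma c) (.some x₄ y₄ h₄) =
      2 * CensusX42.sigmaHeight W p ((W.baseChange ℚ_[p]).formalSigma c) (.some x₁ y₁ h₁) +
        2 * CensusX42.sigmaHeight W p ((W.baseChange ℚ_[p]).formalSigma c) (.some x₂ y₂ h₂) := by
  set V := W.baseChange ℚ_[p] with hVdef
  haveI : V.IsElliptic := by rw [hVdef]; infer_instance
  haveI : V.IsIntegral ℤ_[p] := by rw [hVdef]; infer_instance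
  have hmul : padicLog_mul p := padicLog_mul_holds p
  -- the theta relation at the deep points `P, Q` over `ℚ_p`
  have hθ := theta_at_points_formalSigma V hc (nonsingular_ratCast (p := p) h₁) (nonsingular_ratCast (p := p) h₂)
    hx₁ hx₂
  have hS' : (.some (x₁ : ℚ_[p]) (y₁ : ℚ_[p]) (nonsingular_ratCast h₁) : V.toAffine.Point) +
      .some (x₂ : ℚ_[p]) (y₂ : ℚ_[p]) (nonsingular_ratCast h₂) =
        .some (x₃ : ℚ_[p]) (y₃ : ℚ_[p]) (nonsingular_ratCast h₃) := by
    rw [← toPadicPoint_some (p := p) h₁, ← toPadicPoint_some (p := p) h₂, ← map_add, hS, toPadicPoint_some]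
  have hD' : (.some (x₁ : ℚ_[p]) (y₁ : ℚ_[p]) (nonsingular_ratCast h₁) : V.toAffine.Point) -
      .some (x₂ : ℚ_[p]) (y₂ : ℚ_[p]) (nonsingular_ratCast h₂) =
        .some (x₄ : ℚ_[p]) (y₄ : ℚ_[p]) (nonsingular_ratCast h₄) := by
    rw [← toPadicPoint_some (p := p) h₁, ← toPadicPoint_some (p := p) h₂, ← map_sub, hD, toPadicPoint_some]
  rw [hS', hD'] at hθ
  change padicEval (V.formalSigma c) (-(x₃ : ℚ_[p]) / (y₃ : ℚ_[p])) *
      padicEval (V.formalSigma c) (-(x₄ : ℚ_[p]) / (y₄ : ℚ_[p])) = _ at hθ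
  -- Néron's denominator law
  have hden := den_mul_den_eq_of_hasNonsingularReductionAt_right W h₁ h₂ h₃ h₄ hx hS hD hns
  have hdenp : ((x₃.den : ℚ) : ℚ_[p]) * ((x₄.den : ℚ) : ℚ_[p]) =
      ((x₁.den : ℚ) : ℚ_[p]) ^ 2 * ((x₂.den : ℚ) : ℚ_[p]) ^ 2 * ((x₁ : ℚ_[p]) - x₂) ^ 2 := by
    have := congrArg (fun q : ℚ => (q : ℚ_[p])) hden
    push_cast at this ⊢
    exact this
  -- non-vanishing
  have hσ₁ := padicEval_formalSigma_param_ne_zero V hc (nonsingular_ratCast (p := p) h₁).1 hx₁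
  have hσ₂ := padicEval_formalSigma_param_ne_zero V hc (nonsingular_ratCast (p := p) h₂).1 hx₂
  have hσ₃ := padicEval_formalSigma_param_ne_zero V hc (nonsingular_ratCast (p := p) h₃).1 hx₃
  have hσ₄ := padicEval_formalSigma_param_ne_zero V hc (nonsingular_ratCast (p := p) h₄).1 hx₄
  have hd : ∀ x : ℚ, ((x.den : ℚ) : ℚ_[p]) ≠ 0 := fun x => by exact_mod_cast x.den_nz
  have hδ : (x₁ : ℚ_[p]) - x₂ ≠ 0 := sub_ne_zero.mpr (by exact_mod_cast hx)
  -- logarithms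
  have hlogd : padicLog p ((x₃.den : ℚ) : ℚ_[p]) + padicLog p ((x₄.den : ℚ) : ℚ_[p]) =
      2 * padicLog p ((x₁.den : ℚ) : ℚ_[p]) + 2 * padicLog p ((x₂.den : ℚ) : ℚ_[p]) +
        2 * padicLog p ((x₁ : ℚ_[p]) - x₂) := by
    rw [← hmul (hd x₃) (hd x₄), hdenp, hmul (mul_ne_zero (pow_ne_zero 2 (hd x₁))
      (pow_ne_zero 2 (hd x₂))) (pow_ne_zero 2 hδ), hmul (pow_ne_zero 2 (hd x₁))
      (pow_ne_zero 2 (hd x₂)), padicLog_sq (hd x₁), padicLog_sq (hd x₂), padicLog_sq hδ]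
  have hlogσ : padicLog p (padicEval (V.formalSigma c) (-(x₃ : ℚ_[p]) / (y₃ : ℚ_[p]))) +
      padicLog p (padicEval (V.formalSigma c) (-(x₄ : ℚ_[p]) / (y₄ : ℚ_[p]))) =
        padicLog p ((x₁ : ℚ_[p]) - x₂) + 2 * padicLog p (padicEval (V.formalSigma c) (-(x₁ : ℚ_[p]) / (y₁ : ℚ_[p]))) +
          2 * padicLog p (padicEval (V.formalSigma c) (-(x₂ : ℚ_[p]) / (y₂ : ℚ_[p]))) := by
    have hδ' : (x₂ : ℚ_[p]) - x₁ ≠ 0 := by rw [← neg_sub]; exact neg_ne_zero.mpr hδ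
    rw [← hmul hσ₃ hσ₄, hθ, hmul (mul_ne_zero hδ' (pow_ne_zero 2 hσ₁)) (pow_ne_zero 2 hσ₂),
      hmul hδ' (pow_ne_zero 2 hσ₁), padicLog_sq hσ₁, padicLog_sq hσ₂, ← neg_sub, padicLog_neg hδ]
  simp only [PSSigmaLineFamilyValues.sigmaHeight_some]
  linear_combination hlogd - 2 * hlogσ

end Heights

end Summit.BirchSwinnertonDyer.BirchSwinnertonDyer.Theorems.PSSigmaLineFamilyParallelogram

end
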